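import Summits.HodgeConjecture.HodgeConjecture.Theorems.HLiu418E1pOfE1
import Summits.HodgeConjecture.HodgeConjecture.Theorems.F0P5TP2Holds
import Literature.NumberTheory.Automorphic.UnitaryCurveCotangentSpectralProjectionHerm
import Literature.NumberTheory.Automorphic.UnitaryCurveCohCotangentFormsContinuous
import Literature.NumberTheory.Automorphic.HilbertRepSpectrumProofs
import HarnessLib

/-!
# Crux `HLiu418`, floor 0, programme P5 — THE TWO FACES OF THE LETTER E1′hol₂ (`Rogawski1990.curveCohFinComponentUnique_hol`):
# «at most one hol-type discrete `P` with finite component `σ`» ⟺ «multiplicity `≤ 1` in `L²` of every hol-type discrete `P` with finite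
# component `σ`» (on the honest hermitian domain), and the θ-restricted socket E1θ₂ below it

Cell hodgecm-mathlib (D-0151), crux item `HLiu418` = stmt-HodgeConjecture-24832; F0P5-plan (g2) DESK WORD #6 (2026-08-31T04:38:56Z) (α)∕(β), seat
F0P5-p02 (g4).  THEOREMS ONLY (no definition, no instance, no notation, no named fact, no `sorry`); the HOME draft
`F0/P5/p02/E1theta/HLiu418E1TwoFaces.draft-v1.F0P5p02g4.lean` adds a §4 naming the faces as `def`s (not filed).  Count-neutral: nothing printed is discharged; HC_CM is proved only modulo the 7 printed citations (+ declared floor-0 debt)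
until rung 0 closes.

WHAT.
* §1 (Hilbert spaces, any group `G`).  **The diagonal copy** `exists_diagonal_closedSubrep`: for `π` unitary, `P` irreducible closed invariant,
  `Q ≤ Pᗮ` closed invariant with `P ≅ Q` isometrically by `e`, the subspace `D = {(x + e x)/√2}` is irreducible closed invariant, `D ≠ P`, `D ≅ P`,
  and `pr_D v ≠ 0` for every `0 ≠ v ∈ P` ([Dixmier1977, §5.4]).  **Multiplicity `≤ 1` at ONE class** `multiplicity_le_one_of_forall_orthogonal`:
  if no closed invariant `Q ≤ Pᗮ` is unitarily equivalent to `P`, then every irreducible `W ≅ P` equals `P`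
  (★ `ClosedSubrep.exists_le_orthogonal_areUnitarilyEquivalent`, [DeitmarEchterhoff2014, Cor. 6.1.9]) and `multiplicity π P ≤ 1`.
* §2 (any adelic group datum `𝒢`).  `multiplicity_le_one_of_detecting_carrier`: let `S` be a space of continuous left-invariant functions on
  `G(𝔸)` («a Hodge type»: e.g. the cone-holomorphic cotangent forms) STABLE UNDER SPECTRAL PROJECTION (the projection onto any discrete `P` of the
  class of a member of `S` is the class of a member of `S` — the tree's letter (D₂) = ★ `F0P5TP2Holds`), and `fin` a property of discrete `P`
  transported along equivalences of closed subrepresentations («has finite component `σ`»).  If `P` is of type `S` with `fin P`, and `P` is the ONLY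
  discrete `P′` of type `S` with `fin P′`, then `multiplicity (R_μ) P ≤ 1`: an orthogonal equivalent copy `Q` would give the diagonal `D ≠ P` of §1,
  of type `S` (its projection of the `S`-class of `P` is non-zero) with `fin D` — contradicting uniqueness.  `hasFinComponent_of_equiv`: `HasFinComponent σ`
  is such a `fin` (compose the injective `U(J)(𝔸_f)`-intertwiner `σ → P` with the equivalence).
* §3 (the P5 letter binders).  FACE ⟸: `multiplicity_le_one_of_curveCohFinComponentUnique_hol` — E1′hol₂ ⟹ «`multiplicity (R_μ) P ≤ 1` for every
  hol-type discrete `P` of `U(H)` with an irreducible smooth finite component `σ`», on the HONEST DOMAIN `(H.map (cmPlace L ι).1.embedding).IsHermitian`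
  of the spectral-projection letter (D₂) (★ `UnitaryCurveCotangentSpectralProjectionHerm`); antihol twin `…_antihol`.  FACE ⟹:
  `curveCohFinComponentUnique_hol_of_multiplicity` — that σ-relative multiplicity statement (even without the hermitian clause) ⟹ E1′hol₂, by the K-lane
  collapse ★ `E1pOfE1.eq_of_discIdentity_of_holRealised` (which consumes multiplicity `≤ 1` ONLY at the class `P`, which already has finite component
  `σ`) fed with ★ `E1pRealise.archCoefficient_shape` ∕ `holValued_shape` and ★ `E2LevelFinite.admissibleOfHolValued₂_holds` (F0P5-p02 (g3) draft §2).
WHY `E1Criterion` §1 (★ p810861) IS NOT ENOUGH: its dictionary `forall_multiplicity_le_one_iff_*` is GLOBAL (all `P` at once ⟺ `HasMultiplicityOne`);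
the per-class step needs the diagonal copy, and the passage «equivalent copy ⇒ SAME HODGE TYPE» is exactly the spectral-projection letter (D₂).

References: [Dixmier1977] J. Dixmier, *C*-algebras* (1977), §5.4.  [DeitmarEchterhoff2014] A. Deitmar, S. Echterhoff, *Principles of Harmonic
Analysis*, 2nd ed. (2014), Cor. 6.1.9, Thm. 7.3.2.  [BorelJacquet1979] A. Borel, H. Jacquet, Corvallis PSPM 33.1 (1979), §4.6.  [Liu2021] Y. Liu,
Camb. J. Math. 9 (2021), App. D Prop. D.4 (1) and proof (p. 130–131), Rem. D.5.  [Rogawski1990] J. Rogawski, Ann. of Math. Stud. 123, §11.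
-/

set_option autoImplicit false
-- the mandated namespace has the single-problem summit's repeated segment (`HodgeConjecture.HodgeConjecture`)
set_option linter.dupNamespace false

noncomputable section

open MeasureTheory NumberField NumberField.InfinitePlace
open scoped Matrix ComplexOrder InnerProductSpace ENNReal
open Literature.NumberTheory.Automorphic Literature.NumberTheory.Automorphic.UnitaryGroup
open Literature.NumberTheory.Automorphic.UnitaryGroup.CotangentForms (toQuotFun)
open Literature.NumberTheory.Automorphic.UnitaryCurveForms
open Literature.NumberTheory.Automorphic.Liu2021 Literature.NumberTheory.Automorphic.Liu2021.Def411WeilCarriers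
open Literature.NumberTheory.Automorphic.Liu2021.Def411WeilCarriersDoubling
open Literature.NumberTheory.GaloisRepresentations
open Literature.NumberTheory.GelbartRogawski1991 Literature.NumberTheory.GelbartRogawski1991.UnitaryDualPair
open Literature.RepresentationTheory.Liu2021 Literature.RepresentationTheory.HarrisKudlaSweet1996
open Summit.HodgeConjecture.HodgeConjecture.Cruxes.H413.SpectrumJunction

namespace Summit.HodgeConjecture.HodgeConjecture.Cruxes.HLiu418.E1TwoFaces

/-! ## §1 Hilbert-space lemmas: the diagonal copy; multiplicity `≤ 1` at one class -/

section Hilbert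

variable {G H : Type*} [Group G] [NormedAddCommGroup H] [InnerProductSpace ℂ H] [CompleteSpace H]

open ContRepresentation

/-- **The diagonal copy.**  Let `π` be unitary, `P` an irreducible closed subrepresentation and `Q ≤ Pᗮ` a closed subrepresentation
unitarily equivalent to `P` by `e`.  Then `D := {(x + e x)/√2 | x ∈ P}` (the range of the isometric intertwiner `x ↦ (x + e x)/√2`, ★
`ClosedSubrep.ofLinearIsometry`) is an irreducible closed subrepresentation, equivalent to `P`, DIFFERENT from `P` (else `e x ∈ P ∩ Pᗮ`), and no
non-zero vector of `P` is orthogonal to `D` (`⟪(x + e x)/√2, x⟫ = ‖x‖²/√2`). [cite: Dixmier1977, §5.4] [cite: DeitmarEchterhoff2014, Cor. 6.1.9] -/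
theorem exists_diagonal_closedSubrep {π : ContRepresentation ℂ G H} (hπ : π.IsUnitary) (P Q : ClosedSubrep π)
    (hP : P.toContRep.IsTopIrreducible) (hQ : Q ≤ P.orthogonal hπ)
    (he : AreUnitarilyEquivalent P.toContRep Q.toContRep) :
    ∃ D : ClosedSubrep π, D.toContRep.IsTopIrreducible ∧ D ≠ P ∧ Nonempty (P.toContRep.Equiv D.toContRep) ∧
      ∀ v : H, v ∈ P → v ≠ 0 → D.toSubmodule.starProjection v ≠ 0 := by
  obtain ⟨e, heI⟩ := he
  have hnorm : ∀ x : P.toSubmodule, ‖e x‖ = ‖x‖ := (AddMonoidHomClass.isometry_iff_norm e).mp heI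
  -- `e x ⊥ P`
  have hinner0 : ∀ x y : P.toSubmodule, ⟪(x : H), ((e y : Q.toSubmodule) : H)⟫_ℂ = 0 := fun x y =>
    (ClosedSubrep.mem_orthogonal_iff hπ P _).mp (hQ (e y).2) x x.2
  -- `‖x + e x‖ = √2 ‖x‖`
  have hsq : ∀ x : P.toSubmodule, ‖(x : H) + ((e x : Q.toSubmodule) : H)‖ = Real.sqrt 2 * ‖x‖ := fun x => by
    have h1 := norm_add_sq_eq_norm_sq_add_norm_sq_of_inner_eq_zero (𝕜 := ℂ) (x : H) ((e x : Q.toSubmodule) : H) (hinner0 x x)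
    rw [Submodule.norm_coe, Submodule.norm_coe, hnorm x, ← two_mul] at h1
    have h2 : ‖(x : H) + ((e x : Q.toSubmodule) : H)‖ = Real.sqrt (2 * (‖x‖ * ‖x‖)) := by
      rw [← h1, Real.sqrt_mul_self (norm_nonneg _)]
    rw [h2, Real.sqrt_mul' _ (mul_self_nonneg _), Real.sqrt_mul_self (norm_nonneg _)]
  -- the isometry `U x = (√2)⁻¹ • (x + e x)`
  set c : ℝ := (Real.sqrt 2)⁻¹ with hc
  have hc0 : 0 < c := inv_pos.mpr (Real.sqrt_pos.mpr two_pos)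
  let T : P.toSubmodule →ₗ[ℂ] H :=
    { toFun := fun x => (c : ℂ) • ((x : H) + ((e x : Q.toSubmodule) : H))
      map_add' := fun x y => by
        simp only [map_add, Submodule.coe_add, smul_add]
        abel
      map_smul' := fun r x => by
        simp only [map_smul, Submodule.coe_smul, RingHom.id_apply, smul_add, smul_comm (c : ℂ) r] }
  let U : P.toSubmodule →ₗᵢ[ℂ] H :=
    { toLinearMap := T
      norm_map' := fun x => by
        change ‖(c : ℂ) • ((x : H) + ((e x : Q.toSubmodule) : H))‖ = ‖x‖
        rw [norm_smul, Complex.norm_real, Real.norm_eq_abs, abs_of_pos hc0, hsq x, hc, ← mul_assoc,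
          inv_mul_cancel₀ (Real.sqrt_pos.mpr two_pos).ne', one_mul] }
  have hUapply : ∀ x : P.toSubmodule, U x = (c : ℂ) • ((x : H) + ((e x : Q.toSubmodule) : H)) := fun x => rfl
  -- `U` intertwines
  have hU : ∀ (g : G) (x : P.toSubmodule), U (P.toContRep g x) = π g (U x) := fun g x => by
    have h1 : e (P.toContRep g x) = Q.toContRep g (e x) := e.toContIntertwiningMap.isIntertwining g x
    rw [hUapply, hUapply, h1, ClosedSubrep.coe_toContRep_apply, ClosedSubrep.coe_toContRep_apply, map_smul, map_add]
  refine ⟨ClosedSubrep.ofLinearIsometry U hU, (isTopIrreducible_congr (ClosedSubrep.equivOfLinearIsometry U hU)).mp hP, ?_,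
    ⟨ClosedSubrep.equivOfLinearIsometry U hU⟩, ?_⟩
  · -- `D ≠ P`: for a non-zero `x ∈ P`, `U x ∈ D = P` would put `e x = c⁻¹ • U x - x` in `P ∩ Pᗮ = 0`
    intro hDP
    haveI : Nontrivial P.toSubmodule := ((isTopIrreducible_iff _).mp hP).1
    obtain ⟨x, hx⟩ := exists_ne (0 : P.toSubmodule)
    · have hUx : U x ∈ P := hDP.le ((ClosedSubrep.mem_ofLinearIsometry U hU _).mpr ⟨x, rfl⟩)
      have hex : ((e x : Q.toSubmodule) : H) ∈ P.toSubmodule := by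
        have h2 : ((e x : Q.toSubmodule) : H) = (c : ℂ)⁻¹ • U x - (x : H) := by
          rw [hUapply, smul_smul, inv_mul_cancel₀ (by exact_mod_cast hc0.ne'), one_smul, add_sub_cancel_left]
        rw [h2]
        exact P.toSubmodule.sub_mem (P.toSubmodule.smul_mem _ hUx) x.2
      have hex0 : ((e x : Q.toSubmodule) : H) = 0 := by
        have h3 := hinner0 ⟨_, hex⟩ x
        rwa [inner_self_eq_zero] at h3
      apply hx
      have h4 : e x = 0 := by
        ext
        exact hex0
      simpa using h4
  · -- no non-zero vector of `P` is orthogonal to `D`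
    intro v hv hv0 hpr
    rw [Submodule.starProjection_apply_eq_zero_iff] at hpr
    have hmem : U ⟨v, hv⟩ ∈ (ClosedSubrep.ofLinearIsometry U hU).toSubmodule :=
      (ClosedSubrep.mem_ofLinearIsometry U hU _).mpr ⟨⟨v, hv⟩, rfl⟩
    have h1 : ⟪U ⟨v, hv⟩, v⟫_ℂ = 0 := Submodule.inner_right_of_mem_orthogonal hmem hpr
    rw [hUapply, inner_smul_left, inner_add_left, Complex.conj_ofReal] at h1
    have h2 : ⟪(((e ⟨v, hv⟩ : Q.toSubmodule)) : H), v⟫_ℂ = 0 := by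
      have := hinner0 ⟨v, hv⟩ ⟨v, hv⟩
      rwa [← inner_conj_symm, map_eq_zero] at this
    rw [h2, add_zero, mul_eq_zero] at h1
    rcases h1 with h1 | h1
    · exact hc0.ne' (by exact_mod_cast h1)
    · exact hv0 (inner_self_eq_zero.mp h1)

/-- **Multiplicity one AT ONE CLASS, subspace form.**  If no closed invariant `Q ≤ Pᗮ` is unitarily equivalent to the irreducible `P`, then every
irreducible closed `W` unitarily equivalent to `P` IS `P`: either `W ≤ P` (then `W = P`, ★ `ClosedSubrep.eq_of_le_of_isTopIrreducible`) or the
isometric part of `pr_{Pᗮ}|_W` gives an equivalent copy inside `Pᗮ` (★ `ClosedSubrep.exists_le_orthogonal_areUnitarilyEquivalent`).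
[cite: DeitmarEchterhoff2014, Cor. 6.1.9] [cite: Dixmier1977, §5.4] -/
theorem eq_of_areUnitarilyEquivalent_of_forall_orthogonal {π : ContRepresentation ℂ G H} (hπ : π.IsUnitary) (P : ClosedSubrep π)
    (hP : P.toContRep.IsTopIrreducible)
    (h : ∀ Q : ClosedSubrep π, Q ≤ P.orthogonal hπ → ¬ AreUnitarilyEquivalent P.toContRep Q.toContRep)
    (W : ClosedSubrep π) (hW : W.toContRep.IsTopIrreducible) (hWP : AreUnitarilyEquivalent W.toContRep P.toContRep) : W = P := by
  by_cases hle : W ≤ P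
  · exact ClosedSubrep.eq_of_le_of_isTopIrreducible hP ((isTopIrreducible_iff _).mp hW).1 hle
  · exfalso
    obtain ⟨W'', hW''le, hW''e⟩ := ClosedSubrep.exists_le_orthogonal_areUnitarilyEquivalent hπ P W hW hle
    exact h W'' hW''le (hWP.symm.trans hW''e)

/-- **Multiplicity `≤ 1` AT ONE CLASS.**  Under the hypothesis of `eq_of_areUnitarilyEquivalent_of_forall_orthogonal`, `multiplicity π P ≤ 1`
(a pairwise orthogonal family of irreducible closed subrepresentations equivalent to `P` has all its members equal to `P`).
[cite: Dixmier1977, §5.4] [cite: DeitmarEchterhoff2014, Cor. 6.1.9] -/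
theorem multiplicity_le_one_of_forall_orthogonal {π : ContRepresentation ℂ G H} (hπ : π.IsUnitary) (P : ClosedSubrep π)
    (hP : P.toContRep.IsTopIrreducible)
    (h : ∀ Q : ClosedSubrep π, Q ≤ P.orthogonal hπ → ¬ AreUnitarilyEquivalent P.toContRep Q.toContRep) :
    π.multiplicity P.toContRep ≤ 1 := by
  classical
  unfold ContRepresentation.multiplicity
  refine iSup_le fun s => iSup_le fun hs => iSup_le fun _ => ?_
  have hcard : s.card ≤ 1 := Finset.card_le_one.mpr fun a ha b hb => by
    rw [eq_of_areUnitarilyEquivalent_of_forall_orthogonal hπ P hP h a (hs a ha).1 (hs a ha).2,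
      eq_of_areUnitarilyEquivalent_of_forall_orthogonal hπ P hP h b (hs b hb).1 (hs b hb).2]
  exact_mod_cast hcard

end Hilbert

/-! ## §2 Any adelic group datum: uniqueness within a projection-stable Hodge type ⟹ multiplicity `≤ 1` -/

section Adelic

variable {K : Type} [Field K] [NumberField K] {𝒢 : AdelicGroupData.{0} K}
  {μ : Measure 𝒢.automorphicQuotient} [𝒢.IsAutomorphicMeasure μ]

/-- **Uniqueness within a projection-stable type ⟹ multiplicity `≤ 1`.**  `S`: continuous left-invariant functions («a Hodge type») whose classes
are stable under the orthogonal projection onto every discrete `P` (the spectral-projection letter (D₂), [BorelJacquet1979, §4.6]); `fin`: a property of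
discrete `P` invariant under equivalence of closed subrepresentations («finite component `σ`»).  If `P` contains a non-zero member of `S`, `fin P`, and
`P` is the only such discrete representation, then `multiplicity (R_μ) P ≤ 1` — by §1: an orthogonal equivalent copy yields the diagonal `D ≠ P`, which
contains the (non-zero, in `S`) projection of the `S`-class of `P` and satisfies `fin D`. [cite: Dixmier1977, §5.4] [cite: BorelJacquet1979, §4.6]
[cite: DeitmarEchterhoff2014, Cor. 6.1.9 and Thm. 7.3.2] -/
theorem multiplicity_le_one_of_detecting_carrier (S : Submodule ℂ (𝒢.Adelic → ℂ))
    (hSleft : ∀ f ∈ S, ∀ γ ∈ 𝒢.quotientSubgroup, ∀ x, f (γ * x) = f x) (hScont : ∀ f ∈ S, Continuous f)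
    (hTP : ∀ (P : DiscreteAutomorphicRep 𝒢 μ) (f : 𝒢.Adelic → ℂ), f ∈ S → ∀ hf : MemLp (toQuotFun 𝒢 f) 2 μ,
      ∃ f' ∈ S, ∃ hf' : MemLp (toQuotFun 𝒢 f') 2 μ,
        P.space.toSubmodule.starProjection (hf.toLp (toQuotFun 𝒢 f)) = hf'.toLp (toQuotFun 𝒢 f'))
    (fin : DiscreteAutomorphicRep 𝒢 μ → Prop)
    (hfin : ∀ P Q : DiscreteAutomorphicRep 𝒢 μ, Nonempty (P.space.toContRep.Equiv Q.space.toContRep) → fin P → fin Q)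
    (P : DiscreteAutomorphicRep 𝒢 μ) (hP : ∃ f ∈ S, f ≠ 0 ∧ P.ContainsFun f) (hPf : fin P)
    (huniq : ∀ P' : DiscreteAutomorphicRep 𝒢 μ, (∃ f ∈ S, f ≠ 0 ∧ P'.ContainsFun f) → fin P' → P = P') :
    (𝒢.rightRegular μ).multiplicity P.space.toContRep ≤ 1 := by
  refine multiplicity_le_one_of_forall_orthogonal (𝒢.isUnitary_rightRegular μ) P.space P.irreducible fun Q hQ he => ?_
  obtain ⟨D, hDirr, hDP, ⟨Φ⟩, hproj⟩ := exists_diagonal_closedSubrep (𝒢.isUnitary_rightRegular μ) P.space Q P.irreducible hQ he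
  let D' : DiscreteAutomorphicRep 𝒢 μ := ⟨D, hDirr⟩
  obtain ⟨f, hfS, hf0, hfm, hfP⟩ := hP
  -- the class of `f` is non-zero, hence so is its projection onto the diagonal
  have hv0 : hfm.toLp (toQuotFun 𝒢 f) ≠ 0 := toLp_toQuotFun_ne_zero (hSleft f hfS) (hScont f hfS) hfm hf0
  have hpr : D.toSubmodule.starProjection (hfm.toLp (toQuotFun 𝒢 f)) ≠ 0 := hproj _ hfP hv0
  -- which is the class of a member of `S`, necessarily non-zero
  obtain ⟨f', hf'S, hf'm, hpr'⟩ := hTP D' f hfS hfm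
  have hf'0 : f' ≠ 0 := by
    rintro rfl
    have h0 : hf'm.toLp (toQuotFun 𝒢 (0 : 𝒢.Adelic → ℂ)) = 0 :=
      (Lp.eq_zero_iff_ae_eq_zero).mpr (hf'm.coeFn_toLp.trans (Filter.Eventually.of_forall fun _ => rfl))
    exact hpr (hpr'.trans h0)
  -- so the diagonal is of type `S`, with `fin`, hence equal to `P` — absurd
  have hD'S : ∃ f ∈ S, f ≠ 0 ∧ D'.ContainsFun f := by
    refine ⟨f', hf'S, hf'0, hf'm, ?_⟩
    rw [← hpr']
    exact Submodule.starProjection_apply_mem _ _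
  have hPD : P = D' := huniq D' hD'S (hfin P D' ⟨Φ⟩ hPf)
  exact hDP (congrArg DiscreteAutomorphicRep.space hPD).symm

end Adelic

section Unitary

variable {F E : Type} [Field F] [NumberField F] [Field E] [NumberField E] [Algebra F E]
  {c : E ≃ₐ[F] E} {N : ℕ} {J : Matrix (Fin N) (Fin N) E}
  {μ : Measure (adelicGroupData F E c N J).automorphicQuotient} [(adelicGroupData F E c N J).IsAutomorphicMeasure μ]

/-- **`HasFinComponent σ` is transported along equivalences of closed subrepresentations**: compose the injective `U(J)(𝔸_{F,f})`-intertwiner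
`σ → P` with the (injective, `U(J)(𝔸_F)`-equivariant) equivalence `P ≃ Q`. [cite: BorelJacquet1979, §4.6] -/
theorem hasFinComponent_of_equiv (P Q : DiscreteAutomorphicRep (adelicGroupData F E c N J) μ)
    (Φ : P.space.toContRep.Equiv Q.space.toContRep)
    {W : Type} [AddCommGroup W] [Module ℂ W] {σ : Representation ℂ (finAdelic F E c N J) W}
    (h : P.HasFinComponent σ) : Q.HasFinComponent σ := by
  obtain ⟨j, hj⟩ := h
  let ΦI : P.finRep.IntertwiningMap Q.finRep :=
    LinearMap.intertwiningMap_of_isIntertwiningMap P.finRep Q.finRep Φ.toContIntertwiningMap.toContinuousLinearMap.toLinearMap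
      fun k v => Φ.toContIntertwiningMap.isIntertwining (finAdelicToAdelic F E c N J k) v
  exact ⟨ΦI.comp j, fun a b hab => hj (EquivLike.injective Φ hab)⟩

end Unitary

/-! ## §3 The two faces at the P5 letter binders -/

section Faces

/-- **FACE ⟸ (holomorphic): E1′hol₂ ⟹ multiplicity `≤ 1` of every hol-type discrete `P` with an irreducible smooth finite component `σ`**, on the
hermitian domain of (D₂): §2 with `S := holCotForms₂ … 𝔣` (continuous ★ `continuous_of_mem_holCotForms₂`, left-invariant), projection-stability = ★
`F0P5TP2Holds.holCotFormSpectralProjection₂_holds` through ★ `holCotFormSpectralProjection₂.apply_herm`, `fin := HasFinComponent σ`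
(`hasFinComponent_of_equiv`), uniqueness = the letter E1′hol₂ at `σ`. [cite: Liu2021, App. D Prop. D.4 (1) and proof (p. 130–131)]
[cite: Dixmier1977, §5.4] [cite: BorelJacquet1979, §4.6] [cite: DeitmarEchterhoff2014, Cor. 6.1.9 and Thm. 7.3.2] -/
theorem multiplicity_le_one_of_curveCohFinComponentUnique_hol
    (hE1' : Literature.NumberTheory.Rogawski1990.curveCohFinComponentUnique_hol)
    (L : Type) [Field L] [NumberField L] [IsCMField L] (ι : L →+* ℂ) (H : Matrix (Fin 2) (Fin 2) L)
    (dV : Fin 2 → L) (hdV : ∀ i, IsCMField.complexConj L (dV i) = dV i) (hdV0 : ∀ i, dV i ≠ 0)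
    (t : L) (ht : t ≠ 0) (g : GL (Fin 2) L)
    (hg : formCongr ((IsCMField.complexConj L : L ≃ₐ[↥(maximalRealSubfield L)] L) : L →+* L) g (t • H) = Matrix.diagonal dV)
    (hH : (H.map (cmPlace L ι).1.embedding).IsHermitian)
    (hsig : ∃ T : GL (Fin 2) ℂ, formCongr (starRingEnd ℂ) T ((Matrix.diagonal dV).map ι) = Matrix.diagonal ![(1 : ℂ), -1])
    (hdef : ∀ τ' : L →+* ℂ, InfinitePlace.mk τ' ≠ InfinitePlace.mk ι → ((Matrix.diagonal dV).map τ').PosDef)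
    (h4 : 4 ≤ Module.finrank ℚ L)
    (𝔣 : ConeFrame L H (cmPlace L ι))
    (μ : Measure (adelicGroupData (↥(maximalRealSubfield L)) L (IsCMField.complexConj L) 2 H).automorphicQuotient)
    [(adelicGroupData (↥(maximalRealSubfield L)) L (IsCMField.complexConj L) 2 H).IsAutomorphicMeasure μ]
    {W : Type} [AddCommGroup W] [Module ℂ W]
    (σ : Representation ℂ (finAdelic (↥(maximalRealSubfield L)) L (IsCMField.complexConj L) 2 H) W)
    (hirr : σ.IsIrreducible) (hsm : σ.IsSmooth)
    (P : DiscreteAutomorphicRep (adelicGroupData (↥(maximalRealSubfield L)) L (IsCMField.complexConj L) 2 H) μ)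
    (hP : P.IsHolCotangentAt₂ (IsCMField.complexConj_ne_one L) (UnitaryGroup.complexConj_smul_infinitePlace L) (cmPlace L ι) 𝔣)
    (hj : P.HasFinComponent σ) :
    ((adelicGroupData (↥(maximalRealSubfield L)) L (IsCMField.complexConj L) 2 H).rightRegular μ).multiplicity P.space.toContRep ≤ 1 :=
  multiplicity_le_one_of_detecting_carrier
    (holCotForms₂ (↥(maximalRealSubfield L)) L (IsCMField.complexConj L) H (IsCMField.complexConj_ne_one L)
      (UnitaryGroup.complexConj_smul_infinitePlace L) (cmPlace L ι) 𝔣)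
    (fun _ hf => E2Density.leftInvariant_of_mem_holCotForms₂ hf)
    (fun _ hf => continuous_of_mem_holCotForms₂ _ _ _ _ _ _ _ 𝔣 hf)
    (fun P' f hf hfm => holCotFormSpectralProjection₂.apply_herm F0P5TP2Holds.holCotFormSpectralProjection₂_holds
      L ι H dV hdV hdV0 t ht g hg hH hsig hdef h4 𝔣 μ P' f hf hfm)
    (fun P' => P'.HasFinComponent σ) (fun P₁ P₂ hΦ h => hΦ.elim fun Φ => hasFinComponent_of_equiv P₁ P₂ Φ h)
    P hP hj (fun P' hP' hj' => hE1' L ι H dV hdV hdV0 t ht g hg hsig hdef h4 𝔣 μ W σ hirr hsm P P' hP hP' hj hj')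

/-- **FACE ⟸ (antiholomorphic)**: the same with `S := (holCotForms₂ … 𝔣).map conjFun₂`, ★ `F0P5TP2Holds.antiholCotFormSpectralProjection₂_holds`
and the letter E1′antihol₂ `Rogawski1990.curveCohFinComponentUnique_antihol` (itself ⟸ E1′hol₂, ★ `curveCohFinComponentUnique_antihol_of_hol`).
[cite: Liu2021, App. D Prop. D.4 (1) and proof (p. 130–131)] [cite: Dixmier1977, §5.4] [cite: BorelWallach2000, VII 2.10]
[cite: DeitmarEchterhoff2014, Cor. 6.1.9 and Thm. 7.3.2] -/
theorem multiplicity_le_one_of_curveCohFinComponentUnique_antihol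
    (hE1' : Literature.NumberTheory.Rogawski1990.curveCohFinComponentUnique_antihol)
    (L : Type) [Field L] [NumberField L] [IsCMField L] (ι : L →+* ℂ) (H : Matrix (Fin 2) (Fin 2) L)
    (dV : Fin 2 → L) (hdV : ∀ i, IsCMField.complexConj L (dV i) = dV i) (hdV0 : ∀ i, dV i ≠ 0)
    (t : L) (ht : t ≠ 0) (g : GL (Fin 2) L)
    (hg : formCongr ((IsCMField.complexConj L : L ≃ₐ[↥(maximalRealSubfield L)] L) : L →+* L) g (t • H) = Matrix.diagonal dV)
    (hH : (H.map (cmPlace L ι).1.embedding).IsHermitian)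
    (hsig : ∃ T : GL (Fin 2) ℂ, formCongr (starRingEnd ℂ) T ((Matrix.diagonal dV).map ι) = Matrix.diagonal ![(1 : ℂ), -1])
    (hdef : ∀ τ' : L →+* ℂ, InfinitePlace.mk τ' ≠ InfinitePlace.mk ι → ((Matrix.diagonal dV).map τ').PosDef)
    (h4 : 4 ≤ Module.finrank ℚ L)
    (𝔣 : ConeFrame L H (cmPlace L ι))
    (μ : Measure (adelicGroupData (↥(maximalRealSubfield L)) L (IsCMField.complexConj L) 2 H).automorphicQuotient)
    [(adelicGroupData (↥(maximalRealSubfield L)) L (IsCMField.complexConj L) 2 H).IsAutomorphicMeasure μ]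
    {W : Type} [AddCommGroup W] [Module ℂ W]
    (σ : Representation ℂ (finAdelic (↥(maximalRealSubfield L)) L (IsCMField.complexConj L) 2 H) W)
    (hirr : σ.IsIrreducible) (hsm : σ.IsSmooth)
    (P : DiscreteAutomorphicRep (adelicGroupData (↥(maximalRealSubfield L)) L (IsCMField.complexConj L) 2 H) μ)
    (hP : P.IsAntiholCotangentAt₂ (IsCMField.complexConj_ne_one L) (UnitaryGroup.complexConj_smul_infinitePlace L) (cmPlace L ι) 𝔣)
    (hj : P.HasFinComponent σ) :
    ((adelicGroupData (↥(maximalRealSubfield L)) L (IsCMField.complexConj L) 2 H).rightRegular μ).multiplicity P.space.toContRep ≤ 1 :=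
  multiplicity_le_one_of_detecting_carrier
    ((holCotForms₂ (↥(maximalRealSubfield L)) L (IsCMField.complexConj L) H (IsCMField.complexConj_ne_one L)
      (UnitaryGroup.complexConj_smul_infinitePlace L) (cmPlace L ι) 𝔣).map
        (conjFun₂ (↥(maximalRealSubfield L)) L (IsCMField.complexConj L) H))
    (fun _ hf => E2Density.leftInvariant_of_mem_cohForms₂ (Submodule.mem_sup_right hf))
    (fun _ hf => continuous_of_mem_map_conjFun₂ _ _ _ _ _ _ _ 𝔣 hf)
    (fun P' f hf hfm => antiholCotFormSpectralProjection₂.apply_herm F0P5TP2Holds.antiholCotFormSpectralProjection₂_holds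
      L ι H dV hdV hdV0 t ht g hg hH hsig hdef h4 𝔣 μ P' f hf hfm)
    (fun P' => P'.HasFinComponent σ) (fun P₁ P₂ hΦ h => hΦ.elim fun Φ => hasFinComponent_of_equiv P₁ P₂ Φ h)
    P hP hj (fun P' hP' hj' => hE1' L ι H dV hdV hdV0 t ht g hg hsig hdef h4 𝔣 μ W σ hirr hsm P P' hP hP' hj hj')

/-- **FACE ⟹ (holomorphic): the σ-relative multiplicity statement ⟹ E1′hol₂.**  The K-lane collapse ★ `E1pOfE1.eq_of_discIdentity_of_holRealised`
consumes multiplicity `≤ 1` ONLY at the class `P`, which by hypothesis is hol-type with finite component `σ`; the disc identity with value and the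
realisation of `σ` in the hol classes of `P`, `P′` are ★ `E1pRealise.archCoefficient_shape` ∕ `holValued_shape`, admissibility of `σ` is ★
`E2LevelFinite.admissibleOfHolValued₂_holds` (F0P5-p02 (g3) socket draft §2, σ-relative).  No hermitian clause is needed in this direction.
[cite: Liu2021, App. D, proof of Prop. D.4 (p. 130–131)] [cite: Rogawski1990, §11.1 Prop. 11.1.1; Thm. 11.5.1] [cite: BorelJacquet1979, §4.6] -/
theorem curveCohFinComponentUnique_hol_of_multiplicity
    (hm : ∀ (L : Type) [Field L] [NumberField L] [IsCMField L] (ι : L →+* ℂ) (H : Matrix (Fin 2) (Fin 2) L)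
      (dV : Fin 2 → L) (_hdV : ∀ i, IsCMField.complexConj L (dV i) = dV i) (_hdV0 : ∀ i, dV i ≠ 0)
      (t : L) (_ht : t ≠ 0) (g : GL (Fin 2) L),
      formCongr ((IsCMField.complexConj L : L ≃ₐ[↥(maximalRealSubfield L)] L) : L →+* L) g (t • H) = Matrix.diagonal dV →
      (∃ T : GL (Fin 2) ℂ, formCongr (starRingEnd ℂ) T ((Matrix.diagonal dV).map ι) = Matrix.diagonal ![(1 : ℂ), -1]) →
      (∀ τ' : L →+* ℂ, InfinitePlace.mk τ' ≠ InfinitePlace.mk ι → ((Matrix.diagonal dV).map τ').PosDef) →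
      4 ≤ Module.finrank ℚ L →
      ∀ (𝔣 : ConeFrame L H (cmPlace L ι))
        (μ : Measure (adelicGroupData (↥(maximalRealSubfield L)) L (IsCMField.complexConj L) 2 H).automorphicQuotient)
        [(adelicGroupData (↥(maximalRealSubfield L)) L (IsCMField.complexConj L) 2 H).IsAutomorphicMeasure μ]
        (W : Type) [AddCommGroup W] [Module ℂ W]
        (σ : Representation ℂ (finAdelic (↥(maximalRealSubfield L)) L (IsCMField.complexConj L) 2 H) W),
        σ.IsIrreducible → σ.IsSmooth →
      ∀ P : DiscreteAutomorphicRep (adelicGroupData (↥(maximalRealSubfield L)) L (IsCMField.complexConj L) 2 H) μ,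
        P.IsHolCotangentAt₂ (IsCMField.complexConj_ne_one L) (UnitaryGroup.complexConj_smul_infinitePlace L) (cmPlace L ι) 𝔣 →
        P.HasFinComponent σ →
        ((adelicGroupData (↥(maximalRealSubfield L)) L (IsCMField.complexConj L) 2 H).rightRegular μ).multiplicity P.space.toContRep ≤ 1) :
    Literature.NumberTheory.Rogawski1990.curveCohFinComponentUnique_hol := by
  intro L _ _ _ ι H dV hdV hdV0 t ht g hg hsig hdef h4 𝔣 μ _ W _ _ σ hirr hsm P P' hP hP' hj hj'
  obtain ⟨τ, hτ⟩ := UnitaryGroup.exists_infinitePlace_ne L h4 ι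
  have hanis := S1BettiSliceExclusion.anisotropic_of_formCongr_posDef L H t g dV hg τ (hdef τ hτ)
  haveI := UnitaryGroup.compactSpace_adelicGroupData_automorphicQuotient L 2 H hanis
  obtain ⟨m, hm'⟩ := E1pRealise.archCoefficient_shape L ι H dV hdV hdV0 t ht g hg hsig hdef h4 𝔣 μ
  obtain ⟨ψ, hE, hV, hne⟩ := E1pRealise.holValued_shape L ι H dV hdV hdV0 t ht g hg hsig hdef h4 𝔣 μ W σ hirr hsm P hP hj
  obtain ⟨ψ', hE', hV', hne'⟩ := E1pRealise.holValued_shape L ι H dV hdV hdV0 t ht g hg hsig hdef h4 𝔣 μ W σ hirr hsm P' hP' hj'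
  have hadm : σ.IsAdmissible :=
    E2LevelFinite.admissibleOfHolValued₂_holds L ι H dV hdV hdV0 t ht g hg hsig hdef h4 𝔣 μ P W σ hirr hsm ψ hE hV hne
  exact E1pOfE1.eq_of_discIdentity_of_holRealised (hm L ι H dV hdV hdV0 t ht g hg hsig hdef h4 𝔣 μ W σ hirr hsm P hP hj)
    m hm' σ hirr hadm ψ hE hV hne ψ' hE' hV' hne'

end Faces



end Summit.HodgeConjecture.HodgeConjecture.Cruxes.HLiu418.E1TwoFaces

end
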